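import Summits.RiemannHypothesis.RiemannHypothesis.Theorems.TiltedLandingLaw421R3Lens1Pinning

/-! # WindowBooks-v3 — W′: the POPULATION-TRACKED window books and the (K) converter to the rate half (lens-2 g10, O11-b as RE-POINTED by (CA800))
**v3 = v2 (32057f708dc1cf1d) with the tracker RE-TYPED T1 → T1″ ADOPTION after crit-1 g7 CUT 47 (U-EXT-1 design F*: the lowest native's kid is
CAPTURED just outside its closed Jensen disc by a far taller disc-toucher under strong tilt, `kidsQ f 0 i = ∅`, so the nearest-KID tracker — and the
all-kids variant — go extinct at a charged level and FIT′'s `0 < mass′_k` dies on the row; with ADOPTION the displaced kid is the heir and the books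
survive, c′ ≈ 1.41 there).  Only §1's heir rule changes (plus the two §2 lines that read it); §3/§4 — laws, kernel, read-back — are v2 VERBATIM.**
v2 = v1 (f3357e2cb1f03938) with FLOOR folded into FIT′ (the free `X` eliminated: the kernel lower-bounds `Σ_{j≤k} mass′_j` by `(k+1)·mass′_k`, M′ antitone).

WORKFILE (crux `Lens2_WindowBooks_v3.lean`), registry-neutral: the skeleton OF RECORD stays `Lines/trkD_v11q.lean` e5f3c2cea72a0413; nothing here is a
registry stub.  ONE TREE import `…R3Lens1Pinning` (#1202-line modules; it re-exports the books `…R3PurseBooks/…R3RateBooksQ/…R3PurseHalfX`, the SUCC chain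
`…R3Lens1CoverageRS2/R` and `RhW08.SuccB.stTrkDQ_succ_of_nested`).  No image, no Cruxes file is imported.

TRACKER RULE (the operational rule posted for instr-1's E13.4, typed below).
(T0) `popQ … 0` = ALL level-0 band states of `StTrkDQ … 0` (one entry per zero; multiplicity ignored; junk `∅` only if that set is infinite, which a legal
frame never is — isolated zeros of `f ≢ 0` in a bounded box).  (T1) HEIR: `kidsQ f j v` = the upper zeros `w` of `f^{(j+1)}` in `v`'s CLOSED Jensen disc
(`NestedStep v w`, the tree's and lens-1's currency — `TopPinning`'s first disjunct); (T1″, CUT 47) `IsHeirQ … j v w` = the kid NEAREST to `v` (ties: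
smaller `re`, then smaller `im`; a total order), and if `v` has NO kid, the nearest ADOPTION candidate = level-(j+1) BAND state not higher than `v`
(`adoptQ`; same key) ⇒ at most ONE heir (`isHeirQ_unique`), `Im heir ≤ Im parent` in both tiers (`im_sq_le_of_isHeirQ`); `popQ … (j+1)` = the heirs of
the level-`j` members, as a SET (shared heirs MERGE).
(T2) A member with no kid AND no adoption candidate DROPS OUT and its energy leaves the books — booked as DISSIPATED, never as lost: so W′ can NOT be made false by drop-out/merge
bookkeeping, and influx/capture is impossible BY DEFINITION (every level-(j+1) member is an heir of a level-j member and `Im heir ≤ Im parent`): tracked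
mass and tracked energy are NON-INCREASING — the (K) lemmas `trackedMass_succ_le` (M′) / `trackedEnergy_succ_le` below, not laws.
(T3) `trackedEnergyQ … j = Σ_{w ∈ popQ j} η²(Im w)²/s²`, `trackedMassQ … j = #popQ j`.
CHILD-EXISTENCE INPUT ASSUMED IN THE DEFINITIONS: NONE (neither lens-1's `TopLinkLawQ`/#1202 link output nor a ∀-member `NestedStep` axiom).  Where an heir
fails to exist the lineage ends (and the ALIVE count `mass′_k` in FIT′ is smaller); pinning enters only through the registry SUCC stubs (`TopPinning`, `RegUmbrella11S`) as in v11q.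

LAWS (typed OPEN, bench items; E13.5/CUT 46 values are floats, indicative only): `TrackedDissipationLawQ c aH` (W′) · `ChargedLiftLawQ aY` (SIGNED
cumulative charged change of the lowest band height ≥ −aY, HEIGHT currency — the head's `EnergyRiseLawQ aR` is ENERGY currency and cannot bound a height
rise near the axis, factor `s/(η²·lowH)` unbounded, hence replaced; «Y-rises 0» ⇒ aY = 0) · `FitTQ c aH aY` (the design inequality, with the ALIVE count
`mass′_k` at the charged level; v1's FLOOR(X) + FIT′(X) imply it).  KERNEL (K, sorry-free): `restRateBotPQ_of_tracked : 0 < c → W′ → LIFT → FIT′ → RestRateBotPQ halfPurse`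
— it replaces the WHOLE second binder `hR : RhW08.RateSplit.RateLawsHalfQ` of `RhW08.Lens1Coverage.TiltedLandingLaw421R_of_regHungCut10S`; read-back
`law421R_of_tracked` concludes the crux decl `…Theses.EarlyAppointments.TiltedLandingLaw421R` BY NAME from `TopPinning`, `RegUmbrella11S` and the three laws.
HONEST LABEL: W′ is NOT K-level (CUT 46 §(4)(a): monotonicity is definitional here, the RATE `c` is Euler-order, OPEN); LIFT/FIT′ are OPEN bench items.
Nothing here bears on the truth of RH; RH is not proved; 33346/33347 OPEN; checked ≠ landed ≠ proved. -/

namespace RhW08.TrackedWindow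

open Complex
open RhW08.Round1 RhW08.StSwap RhW08.Round2 RhW08.QuadW RhW08.SealSwapQ RhW08.PurseP RhIdea6.G17.W07C7 RhIdea6.G17.W07C7.Rev6
open RhW08.SealSwap (PBot)
open RhIdea6.G18.W07C8.Law421BirthS RhIdea6.G19.W07C11.Seam RhIdea6.G20.W07C12.Frac RhIdea6.G20.W07C12.StColP RhW07.C12.FieldSplit RhW07.C14.TwoSided RhW07.C14.Classes

/-! ## §1 The tracker (definitions) -/

/-- (T1) the KIDS of `v` at level `j`: the upper zeros of `f^{(j+1)}` in `v`'s closed Jensen disc. -/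
def kidsQ (f : ℂ → ℂ) (j : ℕ) (v : ℂ) : Set ℂ := {w : ℂ | iteratedDeriv (j + 1) f w = 0 ∧ 0 < w.im ∧ NestedStep v w}

/-- (T1) the total tie-break order among kids of `v`: nearer to `v`; ties smaller `re`; then `im ≤`. -/
def KidKeyLEQ (v w w' : ℂ) : Prop :=
  normSq (w - v) < normSq (w' - v) ∨ (normSq (w - v) = normSq (w' - v) ∧ (w.re < w'.re ∨ (w.re = w'.re ∧ w.im ≤ w'.im)))

/-- (T1) `w` is the KEY-MINIMAL element of `S` seen from `v` (a member preceding every member in the tie-break order). -/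
def IsKeyMinQ (v : ℂ) (S : Set ℂ) (w : ℂ) : Prop := w ∈ S ∧ ∀ w' ∈ S, KidKeyLEQ v w w'

/-- (K) key-minimal elements are unique (the key is a total order). -/
theorem isKeyMinQ_unique {v : ℂ} {S : Set ℂ} {w₁ w₂ : ℂ} (h₁ : IsKeyMinQ v S w₁) (h₂ : IsKeyMinQ v S w₂) : w₁ = w₂ := by
  have a := h₁.2 w₂ h₂.1
  have b := h₂.2 w₁ h₁.1
  simp only [KidKeyLEQ] at a b
  apply Complex.ext
  · rcases a with a | ⟨ha, a | ⟨ha', a'⟩⟩ <;> rcases b with b | ⟨hb, b | ⟨hb', b'⟩⟩ <;> linarith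
  · rcases a with a | ⟨ha, a | ⟨ha', a'⟩⟩ <;> rcases b with b | ⟨hb, b | ⟨hb', b'⟩⟩ <;> linarith

/-- (T1″, CUT 47) the ADOPTION candidates of `v` at level `j` (consulted only when `v` has NO kid): the level-(j+1) BAND states not higher than `v`. -/
def adoptQ (η : ℝ) (f : ℂ → ℂ) (x₀ s hmax R Hs : ℝ) (B : ℕ) (j : ℕ) (v : ℂ) : Set ℂ :=
  {w : ℂ | StTrkDQ η f x₀ s hmax R Hs B (j + 1) w ∧ w.im ≤ v.im}

/-- (T1″) `w` is THE HEIR of `v` at level `j`: the nearest KID (key-minimal in `kidsQ`); if `v` has no kid at all, the nearest ADOPTION candidate. -/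
def IsHeirQ (η : ℝ) (f : ℂ → ℂ) (x₀ s hmax R Hs : ℝ) (B : ℕ) (j : ℕ) (v w : ℂ) : Prop :=
  IsKeyMinQ v (kidsQ f j v) w ∨ ((∀ u, u ∉ kidsQ f j v) ∧ IsKeyMinQ v (adoptQ η f x₀ s hmax R Hs B j v) w)

/-- (K) at most ONE heir per member (the two tiers are exclusive; each tier has a unique key-minimal element). -/
theorem isHeirQ_unique {η : ℝ} {f : ℂ → ℂ} {x₀ s hmax R Hs : ℝ} {B j : ℕ} {v w₁ w₂ : ℂ} (h₁ : IsHeirQ η f x₀ s hmax R Hs B j v w₁)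
    (h₂ : IsHeirQ η f x₀ s hmax R Hs B j v w₂) : w₁ = w₂ := by
  rcases h₁ with h₁ | ⟨hn₁, h₁⟩ <;> rcases h₂ with h₂ | ⟨hn₂, h₂⟩
  · exact isKeyMinQ_unique h₁ h₂
  · exact absurd h₁.1 (hn₂ w₁)
  · exact absurd h₂.1 (hn₁ w₂)
  · exact isKeyMinQ_unique h₁ h₂

/-- (K) an heir is never higher than its parent (squares): a kid sits in the closed Jensen disc, an adopted state is lower by definition and upper. -/
theorem im_sq_le_of_isHeirQ {η : ℝ} {f : ℂ → ℂ} {x₀ s hmax R Hs : ℝ} {B j : ℕ} {v w : ℂ} (h : IsHeirQ η f x₀ s hmax R Hs B j v w) :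
    w.im ^ 2 ≤ v.im ^ 2 := by
  rcases h with ⟨hk, -⟩ | ⟨-, ha, -⟩
  · have hn := hk.2.2; unfold NestedStep at hn; nlinarith [sq_nonneg (w.re - v.re)]
  · have h0 : 0 < w.im := ha.1.2.2.1
    nlinarith [ha.2]

open Classical in
/-- (T1″) the heir of `v` as a finset (`∅` = drop-out, else the singleton). -/
noncomputable def heirSetQ (η : ℝ) (f : ℂ → ℂ) (x₀ s hmax R Hs : ℝ) (B : ℕ) (j : ℕ) (v : ℂ) : Finset ℂ :=
  if h : ∃ w, IsHeirQ η f x₀ s hmax R Hs B j v w then {Classical.choose h} else ∅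

/-- (K) membership in the heir finset IS being the heir. -/
theorem mem_heirSetQ {η : ℝ} {f : ℂ → ℂ} {x₀ s hmax R Hs : ℝ} {B j : ℕ} {v w : ℂ} :
    w ∈ heirSetQ η f x₀ s hmax R Hs B j v ↔ IsHeirQ η f x₀ s hmax R Hs B j v w := by
  unfold heirSetQ
  split_ifs with h
  · rw [Finset.mem_singleton]
    exact ⟨fun hw => hw ▸ Classical.choose_spec h, fun hw => isHeirQ_unique hw (Classical.choose_spec h)⟩
  · simp only [Finset.notMem_empty, false_iff]
    exact fun hw => h ⟨w, hw⟩

/-- (K) the heir finset has at most one element. -/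
theorem card_heirSetQ_le_one (η : ℝ) (f : ℂ → ℂ) (x₀ s hmax R Hs : ℝ) (B j : ℕ) (v : ℂ) : (heirSetQ η f x₀ s hmax R Hs B j v).card ≤ 1 := by
  unfold heirSetQ; split_ifs <;> simp

open Classical in
/-- (T0) the level-0 band states as a finset (junk `∅` if infinite — never on a legal frame). -/
noncomputable def band0Q (η : ℝ) (f : ℂ → ℂ) (x₀ s hmax R Hs : ℝ) (B : ℕ) : Finset ℂ :=
  if h : {u : ℂ | StTrkDQ η f x₀ s hmax R Hs B 0 u}.Finite then h.toFinset else ∅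

/-- (T0)+(T1) THE TRACKED POPULATION `popQ … j : Finset ℂ`: level 0 = the band states; level `j+1` = the heirs of the level-`j` members (merges allowed). -/
noncomputable def popQ (η : ℝ) (f : ℂ → ℂ) (x₀ s hmax R Hs : ℝ) (B : ℕ) : ℕ → Finset ℂ
  | 0 => band0Q η f x₀ s hmax R Hs B
  | j + 1 => (popQ η f x₀ s hmax R Hs B j).biUnion (heirSetQ η f x₀ s hmax R Hs B j)

/-- (T3) the TRACKED MASS `#popQ j` (a `LevelMeter`). -/
noncomputable def trackedMassQ : LevelMeter := fun η f x₀ s hmax R Hs B j => ((popQ η f x₀ s hmax R Hs B j).card : ℝ)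

/-- (T3) the TRACKED ENERGY `Σ_{w ∈ popQ j} η²(Im w)²/s²` (a `LevelMeter`). -/
noncomputable def trackedEnergyQ : LevelMeter := fun η f x₀ s hmax R Hs B j =>
  ∑ w ∈ popQ η f x₀ s hmax R Hs B j, η ^ 2 * w.im ^ 2 / s ^ 2

/-! ## §2 (K) structure lemmas: members, M′ (mass non-increasing), E′ (energy non-increasing = no influx by definition) -/

/-- (K) on a finite level-0 band set, `popQ … 0` IS that set. -/
theorem mem_popQ_zero {η : ℝ} {f : ℂ → ℂ} {x₀ s hmax R Hs : ℝ} {B : ℕ} (h : {u : ℂ | StTrkDQ η f x₀ s hmax R Hs B 0 u}.Finite) {u : ℂ} :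
    u ∈ popQ η f x₀ s hmax R Hs B 0 ↔ StTrkDQ η f x₀ s hmax R Hs B 0 u := by
  show u ∈ band0Q η f x₀ s hmax R Hs B ↔ _
  unfold band0Q; rw [dif_pos h, Set.Finite.mem_toFinset]; rfl

/-- (K) a level-(j+1) member is the heir of a level-j member (influx impossible by definition). -/
theorem mem_popQ_succ {η : ℝ} {f : ℂ → ℂ} {x₀ s hmax R Hs : ℝ} {B j : ℕ} {w : ℂ} :
    w ∈ popQ η f x₀ s hmax R Hs B (j + 1) ↔ ∃ v ∈ popQ η f x₀ s hmax R Hs B j, IsHeirQ η f x₀ s hmax R Hs B j v w := by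
  show w ∈ (popQ η f x₀ s hmax R Hs B j).biUnion (heirSetQ η f x₀ s hmax R Hs B j) ↔ _
  simp only [Finset.mem_biUnion, mem_heirSetQ]

/-- (K) every tracked member at level `j` of a LEGAL frame is a level-`j` BAND STATE (kids by `stTrkDQ_succ_of_nested`, adopted heirs by definition;
induction); in particular a zero of `f^{(j)}` with `0 < Im ≤ Hs`. -/
theorem stTrkDQ_of_mem_popQ {η : ℝ} {f : ℂ → ℂ} {x₀ s hmax R Hs : ℝ} {B : ℕ} (hE : EngineHyps5 2 η f x₀ s hmax R Hs B) :
    ∀ (j : ℕ) (w : ℂ), w ∈ popQ η f x₀ s hmax R Hs B j → StTrkDQ η f x₀ s hmax R Hs B j w := by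
  intro j
  induction j with
  | zero =>
    intro w hw
    by_cases h : {u : ℂ | StTrkDQ η f x₀ s hmax R Hs B 0 u}.Finite
    · exact (mem_popQ_zero h).1 hw
    · have : w ∈ band0Q η f x₀ s hmax R Hs B := hw
      unfold band0Q at this; rw [dif_neg h] at this; simp at this
  | succ j ih =>
    intro w hw
    obtain ⟨v, hv, hheir⟩ := mem_popQ_succ.1 hw
    rcases hheir with ⟨hk, -⟩ | ⟨-, ha, -⟩
    · exact RhW08.SuccB.stTrkDQ_succ_of_nested hE (ih v hv) hk.1 hk.2.1 hk.2.2
    · exact ha.1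

/-- ★ (K) **M′ — TRACKED MASS IS NON-INCREASING** (each member has at most one heir; shared heirs merge). -/
theorem trackedMass_succ_le (η : ℝ) (f : ℂ → ℂ) (x₀ s hmax R Hs : ℝ) (B j : ℕ) :
    trackedMassQ η f x₀ s hmax R Hs B (j + 1) ≤ trackedMassQ η f x₀ s hmax R Hs B j := by
  unfold trackedMassQ
  have h := Finset.card_biUnion_le_card_mul (popQ η f x₀ s hmax R Hs B j) (heirSetQ η f x₀ s hmax R Hs B j) 1
    (fun v _ => card_heirSetQ_le_one η f x₀ s hmax R Hs B j v)
  rw [mul_one] at h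
  exact_mod_cast h

/-- (K) hence antitone in the level. -/
theorem trackedMass_antitone (η : ℝ) (f : ℂ → ℂ) (x₀ s hmax R Hs : ℝ) (B : ℕ) : Antitone (fun j => trackedMassQ η f x₀ s hmax R Hs B j) :=
  antitone_nat_of_succ_le fun j => trackedMass_succ_le η f x₀ s hmax R Hs B j

/-- (K) M′, second half: the mass is UNCHANGED across a level at which every member has an heir and no two members share one (it drops only at
drop-outs and merges). -/
theorem trackedMass_succ_eq_of_heirs {η : ℝ} {f : ℂ → ℂ} {x₀ s hmax R Hs : ℝ} {B j : ℕ}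
    (hall : ∀ v ∈ popQ η f x₀ s hmax R Hs B j, ∃ w, IsHeirQ η f x₀ s hmax R Hs B j v w)
    (hsep : ∀ v₁ ∈ popQ η f x₀ s hmax R Hs B j, ∀ v₂ ∈ popQ η f x₀ s hmax R Hs B j, ∀ w,
      IsHeirQ η f x₀ s hmax R Hs B j v₁ w → IsHeirQ η f x₀ s hmax R Hs B j v₂ w → v₁ = v₂) :
    trackedMassQ η f x₀ s hmax R Hs B (j + 1) = trackedMassQ η f x₀ s hmax R Hs B j := by
  unfold trackedMassQ
  have hdisj : ((popQ η f x₀ s hmax R Hs B j : Finset ℂ) : Set ℂ).PairwiseDisjoint (heirSetQ η f x₀ s hmax R Hs B j) := by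
    intro v₁ h₁ v₂ h₂ hne
    rw [Function.onFun, Finset.disjoint_left]
    intro w hw₁ hw₂
    exact hne (hsep v₁ h₁ v₂ h₂ w (mem_heirSetQ.1 hw₁) (mem_heirSetQ.1 hw₂))
  have hc : ∀ v ∈ popQ η f x₀ s hmax R Hs B j, (heirSetQ η f x₀ s hmax R Hs B j v).card = 1 := by
    intro v hv
    obtain ⟨w, hw⟩ := hall v hv
    unfold heirSetQ; rw [dif_pos (show ∃ w, IsHeirQ η f x₀ s hmax R Hs B j v w from ⟨w, hw⟩)]; simp
  show (((popQ η f x₀ s hmax R Hs B j).biUnion (heirSetQ η f x₀ s hmax R Hs B j)).card : ℝ) = _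
  rw [Finset.card_biUnion hdisj, Finset.sum_congr rfl hc]; simp

/-- (K) bookkeeping: a sum of non-negative terms over a union is at most the sum of the two sums. -/
theorem sum_union_le_of_nonnegQ {g : ℂ → ℝ} (hg : ∀ b, 0 ≤ g b) (A C : Finset ℂ) : ∑ b ∈ A ∪ C, g b ≤ ∑ b ∈ A, g b + ∑ b ∈ C, g b := by
  have h := Finset.sum_union_inter (s₁ := A) (s₂ := C) (f := g)
  have h0 : 0 ≤ ∑ b ∈ A ∩ C, g b := Finset.sum_nonneg fun b _ => hg b
  linarith

/-- (K) bookkeeping: … and over a `biUnion` at most the iterated sum. -/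
theorem sum_biUnion_le_of_nonnegQ {g : ℂ → ℝ} (hg : ∀ b, 0 ≤ g b) (S : Finset ℂ) (t : ℂ → Finset ℂ) :
    ∑ b ∈ S.biUnion t, g b ≤ ∑ a ∈ S, ∑ b ∈ t a, g b := by
  refine Finset.induction_on S (by simp) ?_
  intro a S ha ih
  rw [Finset.biUnion_insert, Finset.sum_insert ha]
  exact (sum_union_le_of_nonnegQ hg _ _).trans (by linarith)

/-- (K) the tracked energy is non-negative. -/
theorem trackedEnergy_nonneg (η : ℝ) (f : ℂ → ℂ) (x₀ s hmax R Hs : ℝ) (B j : ℕ) : 0 ≤ trackedEnergyQ η f x₀ s hmax R Hs B j :=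
  Finset.sum_nonneg fun w _ => div_nonneg (mul_nonneg (sq_nonneg η) (sq_nonneg w.im)) (sq_nonneg s)

/-- (K) the tracked mass is non-negative. -/
theorem trackedMass_nonneg (η : ℝ) (f : ℂ → ℂ) (x₀ s hmax R Hs : ℝ) (B j : ℕ) : 0 ≤ trackedMassQ η f x₀ s hmax R Hs B j := Nat.cast_nonneg _

/-- ★ (K) **E′ — TRACKED ENERGY IS NON-INCREASING** («influx impossible by definition»; majorisation-free: an heir sits in its parent's Jensen disc or is
adopted LOWER, so `Im² heir ≤ Im² parent`, and a drop-out only removes energy).  W′'s dissipation `E′₀ − E′_{k+1}` is therefore always `≥ 0`; its RATE `c` is the open content. -/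
theorem trackedEnergy_succ_le (η : ℝ) (f : ℂ → ℂ) (x₀ s hmax R Hs : ℝ) (B j : ℕ) :
    trackedEnergyQ η f x₀ s hmax R Hs B (j + 1) ≤ trackedEnergyQ η f x₀ s hmax R Hs B j := by
  have hg : ∀ w : ℂ, 0 ≤ η ^ 2 * w.im ^ 2 / s ^ 2 := fun w => div_nonneg (mul_nonneg (sq_nonneg _) (sq_nonneg _)) (sq_nonneg _)
  show ∑ w ∈ (popQ η f x₀ s hmax R Hs B j).biUnion (heirSetQ η f x₀ s hmax R Hs B j), η ^ 2 * w.im ^ 2 / s ^ 2 ≤ _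
  refine (sum_biUnion_le_of_nonnegQ hg _ _).trans (Finset.sum_le_sum fun v _ => ?_)
  unfold heirSetQ
  split_ifs with h
  · rw [Finset.sum_singleton]
    have hn : (Classical.choose h).im ^ 2 ≤ v.im ^ 2 := im_sq_le_of_isHeirQ (Classical.choose_spec h)
    exact div_le_div_of_nonneg_right (mul_le_mul_of_nonneg_left hn (sq_nonneg η)) (sq_nonneg s)
  · rw [Finset.sum_empty]; exact hg v

/-- (K) hence antitone in the level: `E′_k ≤ E′_j` for `j ≤ k` — no allowance is ever needed for influx. -/
theorem trackedEnergy_antitone (η : ℝ) (f : ℂ → ℂ) (x₀ s hmax R Hs : ℝ) (B : ℕ) : Antitone (fun j => trackedEnergyQ η f x₀ s hmax R Hs B j) :=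
  antitone_nat_of_succ_le fun j => trackedEnergy_succ_le η f x₀ s hmax R Hs B j

/-! ## §3 The laws (typed OPEN bench items) -/

/-- ★ W′ — **TRACKED DISSIPATION LAW** (OPEN; CUT 46: not K-level, alive at `aH = 0` on the influx-free bench): up to every charged level the tracked energy
drops by `≥ c` per tracked member per level, allowance `aH`. -/
def TrackedDissipationLawQ (c : ℝ) (aH : Budget) : Prop :=
  ∀ (η : ℝ) (f : ℂ → ℂ) (x₀ s hmax R Hs : ℝ) (B : ℕ), EngineHyps5 2 η f x₀ s hmax R Hs B →
    ∀ k : ℕ, Charged (PTrkSQ PBot) StTrkDQ ReadyR2 η f x₀ s hmax R Hs B k →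
      c * ∑ j ∈ Finset.range (k + 1), trackedMassQ η f x₀ s hmax R Hs B j
        ≤ trackedEnergyQ η f x₀ s hmax R Hs B 0 - trackedEnergyQ η f x₀ s hmax R Hs B (k + 1) + aH η f x₀ s hmax R Hs B

/-- ★ LIFT — **CHARGED LIFT LAW** (OPEN; HEIGHT currency, signed and cumulative): the charged levels below a charged level never raise the lowest band height
by more than `aY·s/4` in aggregate, i.e. `−aY ≤ chargedDropSumQ (k+1)` («Y-rises 0» on the bench ⇒ `aY = 0`). -/
def ChargedLiftLawQ (aY : Budget) : Prop :=
  ∀ (η : ℝ) (f : ℂ → ℂ) (x₀ s hmax R Hs : ℝ) (B : ℕ), EngineHyps5 2 η f x₀ s hmax R Hs B →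
    ∀ k : ℕ, Charged (PTrkSQ PBot) StTrkDQ ReadyR2 η f x₀ s hmax R Hs B k →
      - aY η f x₀ s hmax R Hs B ≤ chargedDropSumQ η f x₀ s hmax R Hs B (k + 1)

/-- ★ FIT′ — **THE DESIGN INEQUALITY** (OPEN bench item, per frame, at every charged level `k`): some tracked lineage is ALIVE at `k` and
`E′₀ + aH ≤ c·mass′_k·(slack_½ − aY)`, where `mass′_k` = the alive (tracked) count AT the charged level and `slack_½ = slackPQ halfPurse` is the level-0 slack
of the ½-purse (`= slack0Q + (B+1)/2`).  v1's FLOOR(X) ∧ FIT′(X) ⇒ this, for every `X` (`mass′_k ≥ mass′₀ − X > 0`). -/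
def FitTQ (c : ℝ) (aH aY : Budget) : Prop :=
  ∀ (η : ℝ) (f : ℂ → ℂ) (x₀ s hmax R Hs : ℝ) (B : ℕ), EngineHyps5 2 η f x₀ s hmax R Hs B →
    ∀ k : ℕ, Charged (PTrkSQ PBot) StTrkDQ ReadyR2 η f x₀ s hmax R Hs B k →
      0 < trackedMassQ η f x₀ s hmax R Hs B k ∧
        trackedEnergyQ η f x₀ s hmax R Hs B 0 + aH η f x₀ s hmax R Hs B
          ≤ c * trackedMassQ η f x₀ s hmax R Hs B k * (slackPQ halfPurse η f x₀ s hmax R Hs B - aY η f x₀ s hmax R Hs B)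

/-! ## §4 (K) THE CONVERTER: W′ + LIFT + FIT′ ⇒ the rate half at the ½-purse -/

open Classical in
/-- (K) bookkeeping: at most `k` charged levels below `k`. -/
theorem chargeCount_le_levelQ (P St Ready : StatePred) (η : ℝ) (f : ℂ → ℂ) (x₀ s hmax R Hs : ℝ) (B k : ℕ) :
    chargeCount P St Ready η f x₀ s hmax R Hs B k ≤ (k : ℝ) := by
  unfold chargeCount
  have h : ∀ j ∈ Finset.range k, (if Charged P St Ready η f x₀ s hmax R Hs B j then (1 : ℝ) else 0) ≤ 1 := fun j _ => by split_ifs <;> norm_num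
  exact (Finset.sum_le_sum h).trans (by simp)

/-- ★★★ (K) **THE WINDOW-BOOKS CONVERTER** — `0 < c → W′ → LIFT → FIT′ → RestRateBotPQ halfPurse`.
BOOKS: at a charged `k`, M′ (antitone) gives `mass′_j ≥ mass′_k` for all `j ≤ k`, so W′ gives `c·(k+1)·mass′_k ≤ E′₀ − E′_{k+1} + aH ≤ E′₀ + aH`, and FIT′
gives `k + 1 ≤ slack_½ − aY`; then `netCost_all (k+1) = chargeCount (k+1) − chargedDropSum (k+1) ≤ (k+1) + aY ≤ slack_½ ≤ slack_½ + credits (k+1)` —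
exactly the step form `restRateBotPQ_iff_books_step halfPurse` (INIT from `typedPurse ≤ halfPurse`).  Replaces the binder `hR : RhW08.RateSplit.RateLawsHalfQ`. -/
theorem restRateBotPQ_of_tracked {c : ℝ} {aH aY : Budget} (hc : 0 < c) (hW : TrackedDissipationLawQ c aH)
    (hY : ChargedLiftLawQ aY) (hfit : FitTQ c aH aY) : RestRateBotPQ halfPurse := by
  rw [restRateBotPQ_iff_books_step]
  intro η f x₀ s hmax R Hs B hE
  refine ⟨slackPQ_nonneg_of_typed_le hE (typedPurse_le_halfPurse f x₀ s hmax R Hs B), fun k hk => ?_⟩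
  have hWk := hW η f x₀ s hmax R Hs B hE k hk
  have hYk := hY η f x₀ s hmax R Hs B hE k hk
  obtain ⟨hX, hfitk⟩ := hfit η f x₀ s hmax R Hs B hE k hk
  -- (1) the alive count at `k` lower-bounds every earlier level (M′ antitone)
  have hsum : ((k : ℝ) + 1) * trackedMassQ η f x₀ s hmax R Hs B k
      ≤ ∑ j ∈ Finset.range (k + 1), trackedMassQ η f x₀ s hmax R Hs B j := by
    have h1 : ∀ j ∈ Finset.range (k + 1), trackedMassQ η f x₀ s hmax R Hs B k ≤ trackedMassQ η f x₀ s hmax R Hs B j :=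
      fun j hj => trackedMass_antitone η f x₀ s hmax R Hs B (Nat.lt_succ_iff.mp (Finset.mem_range.mp hj))
    refine le_trans (le_of_eq ?_) (Finset.sum_le_sum h1)
    rw [Finset.sum_const, Finset.card_range, nsmul_eq_mul]; push_cast; ring
  -- (2) W′ + FIT′: `k + 1 ≤ slack_½ − aY`
  have hE1 : 0 ≤ trackedEnergyQ η f x₀ s hmax R Hs B (k + 1) := trackedEnergy_nonneg η f x₀ s hmax R Hs B (k + 1)
  have hpos : 0 < c * trackedMassQ η f x₀ s hmax R Hs B k := mul_pos hc hX
  have hk1 : (k : ℝ) + 1 ≤ slackPQ halfPurse η f x₀ s hmax R Hs B - aY η f x₀ s hmax R Hs B := by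
    refine le_of_mul_le_mul_left ?_ hpos
    calc c * trackedMassQ η f x₀ s hmax R Hs B k * ((k : ℝ) + 1)
        = c * (((k : ℝ) + 1) * trackedMassQ η f x₀ s hmax R Hs B k) := by ring
      _ ≤ c * ∑ j ∈ Finset.range (k + 1), trackedMassQ η f x₀ s hmax R Hs B j := mul_le_mul_of_nonneg_left hsum hc.le
      _ ≤ trackedEnergyQ η f x₀ s hmax R Hs B 0 - trackedEnergyQ η f x₀ s hmax R Hs B (k + 1) + aH η f x₀ s hmax R Hs B := hWk
      _ ≤ trackedEnergyQ η f x₀ s hmax R Hs B 0 + aH η f x₀ s hmax R Hs B := by linarith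
      _ ≤ _ := hfitk
  -- (3) the books: count ≤ k+1, the signed charged drops ≥ −aY, credits ≥ 0
  have hcount := chargeCount_le_levelQ (PTrkSQ PBot) StTrkDQ ReadyR2 η f x₀ s hmax R Hs B (k + 1)
  push_cast at hcount
  have hcr := creditsQ_nonneg η f x₀ s hmax R Hs B (k + 1)
  rw [netCostQ_all_eq]
  linarith

/-- ★★ READ-BACK (K modulo the NAMED hypotheses): the CRUX DECL BY NAME from the two registry SUCC stubs (`TopPinning`, `RegUmbrella11S`, shared with
v11q) and lens-2's three window-books laws — `restRateBotPQ_of_tracked` sits exactly where `RhW08.RateSplit.restRateBotPQ_half_of_rateLaws hR` sat. -/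
theorem law421R_of_tracked {c : ℝ} {aH aY : Budget} (hP : RhW08.Lens1Pinning.TopPinning) (hU : RhW08.Lens1Pinning.RegUmbrella11S)
    (hc : 0 < c) (hW : TrackedDissipationLawQ c aH) (hY : ChargedLiftLawQ aY) (hfit : FitTQ c aH aY) :
    Summit.RiemannHypothesis.RiemannHypothesis.Theses.EarlyAppointments.TiltedLandingLaw421R :=
  law421Half_of_succ_rate (RhW08.Lens1Coverage.restSuccBotQ_of_resS
      (RhW08.Lens1Coverage.regRes8S_of_regHungCut10S (RhW08.Lens1Pinning.regHungCut10S_of_topPinning hP hU)))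
    (restRateBotPQ_of_tracked hc hW hY hfit)

/-- (K) the same at `c = 1` (the bench value), the scalar side-condition discharged. -/
theorem law421R_of_tracked_one {aH aY : Budget} (hP : RhW08.Lens1Pinning.TopPinning) (hU : RhW08.Lens1Pinning.RegUmbrella11S)
    (hW : TrackedDissipationLawQ 1 aH) (hY : ChargedLiftLawQ aY) (hfit : FitTQ 1 aH aY) :
    Summit.RiemannHypothesis.RiemannHypothesis.Theses.EarlyAppointments.TiltedLandingLaw421R :=
  law421R_of_tracked hP hU one_pos hW hY hfit

end RhW08.TrackedWindow
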